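import Summits.CriticalPhenomena.CardyFormulaZ2.Theses.CardyBondTriangular
import Summits.CriticalPhenomena.CardyFormulaZ2.Theorems.CardyBondTriangularDiscretisationBridge
import Literature.Probability.Percolation.IsoradialRectangularCrossingsProofs
import Literature.Probability.Percolation.QuadCrossingRotationInvarianceProofs
import Literature.Probability.RandomPlanarGeometry.ImageUnivalent

/-!
# Forward rung over the floor `DiscretisationBridge_skeleton` — line `IsoRectAnchorBridge`
(crux `TriangularToSquareTransport`, item `stmt-CriticalPhenomena-4665`, route
`route-CriticalPhenomena-CardyBondTriangular`; seed `g1-CriticalPhenomena-0787`; planner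
`fwd-rung-CriticalPhenomena-08`, 2026-08-17)

## The rung

`IsoRectAnchorBridge`: for EVERY angle `α ∈ (0, π)`, Cardy's formula in the crude discretisation
`embDomainCrossing` for critical (`q = 1`, canonical isoradial weights `isoRectCriticalProb α`) bond
percolation on the axis-parallel rectangular isoradial lattice `𝕃(α)` (`isoRectEmbedding α`), for all
conformal rectangles, implies Cardy's formula for bond-`ℤ²` at `p = 1/2` in G02's discretisation
(`bondDomainCrossingProb`, i.e. the sub-problem `CardyFormulaZ2`).

* FLOOR (`α = π/2`): `𝕃(π/2)` axis-parallel IS `squareLatticeEmbedding` (`isoRectEmbedding_pi_div_two`)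
  with all weights `1/2` (`prodBernoulli_isoRectCriticalProb_pi_div_two`), so `IsoRectAnchorBridgeAt (π/2)`
  is literally the proved floor `Cruxes.DiscretisationBridge.Birth.DiscretisationBridge_skeleton`
  (witness file `Lines/IsoRectAnchorBridge_special.lean`, no `sorry`).
* ONE MOVE: the hypothesis lattice, parameter `α` extended from `π/2` to `(0, π)`.  The new input the
  floor's same-lattice squeeze lacks is a CROSS-LATTICE transport: DKKMO 2020 Thm 2.1 (`q = 1`) —
  universality of quad-crossing probabilities among the `𝕃(α)` — the tree's named printed fact
  `DKKMO2020_thm21_quadCrossingProb` (per quad; `stub_dkkmoThm21`).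
* RELATION TO THE CRUX: `TriangularToSquareTransport` transports crude crossing limits from bond-`𝕋`
  (three track directions; input [HM24], unreleased) to `ℤ²`; this line is its TWO-direction member
  (`𝕋 ↦ 𝕃(α)`), whose heart is in print.  The two comparison stubs below are the `𝕃(α)`-twins of the
  crux line's directed hearts `Sig.stub_lowerTransport` / `Sig.stub_upperTransport`
  (`Lines/birth.lean`), in the simpler SAME-DOMAIN form (no collars, no thinning): DKKMO is applied at
  two fixed quads `Q_e ≺ R ≺ Q_h` only, all `d_SS`-continuity stays on the reference lattice `ℤ²`
  (`Quad.continuity_of_lemma_5_1 SchrammSmirnov2011_lemma_5_1_holds`, as in the floor), and on `𝕃(α)`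
  only two TOPOLOGICAL inclusions are needed (crude ⊆ raw crossing of the easier quad; raw crossing of
  the harder quad ⊆ crude — the edges of `δ𝕃(α)` have lengths `2cos(α/2)δ, 2sin(α/2)δ ≤ 2δ`, the slack
  of `embDomainCrossing`).
* GEOMETRY: DKKMO compares `𝕃(α)` and `𝕃(π/2)` in DKKMO position (`isoRectDrawing β = e^{iβ/2}·isoRectEmbedding β`);
  un-rotating, the axis-parallel `𝕃(α)` at the quad `R` is compared with `ℤ²` (`squareLatticeEmbedding`,
  SAME mesh `δ`: both lattices are isoradial of radius `δ`) at the ROTATED quad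
  `rotateQuad (α/2 - π/4) R` — hence the rotated quad in the two comparison stubs; the composition
  removes it with `rotateQuad_add` / `rotateQuad_zero` and the conformal invariance of crossing-limit
  targets under rotations (`ConformalRectangle.hasCrossingLimit_iff_of_image_data`).

## Stubs (3) and composition

* `stub_dkkmoThm21 : DKKMO2020_thm21_quadCrossingProb` — the printed input (XL to formalise; named fact).
* `stub_squareLeIsoRect` — given DKKMO: `P_{ℤ²}[crude(rotateQuad θ R, δ)] ≤ P_α[crude(R, δ)] + ε`
  eventually as `δ → 0⁺` (L; provable now: DKKMO at one quad + SS continuity on `ℤ²` + floor stubs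
  `stub_strictlyDominated_shrink/stretch` + `MeckeFlipBridge.crude_subset_crossed` on `ℤ²` + run
  extraction on `𝕃(α)`).
* `stub_isoRectLeSquare` — the reverse inequality (L; same ingredients, run extraction on `ℤ²`,
  path restriction on `𝕃(α)`).
* `isoRectToSquareTransport_of` (PROVED here): the three stubs give the `Φ`-general crude transport
  `𝕃(α) → ℤ²` (the twin of the crux statement with `𝕋 ↦ 𝕃(α)`).
* `IsoRectAnchorBridge_of` (PROVED here): transport at `Φ = cardyFunction`, then the floor.
-/

open Filter Topology Set

namespace Summit.CriticalPhenomena.CardyFormulaZ2.Cruxes.TriangularToSquareTransport.IsoRectRung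

/-! ### The rung (verbatim from the planner's Sketch.lean) -/

/-- The rung at angle `α`: crude Cardy on `𝕃(α)` (axis-parallel, canonical `q = 1` weights) for
every conformal rectangle implies G02 Cardy for bond-`ℤ²` at `1/2` for every conformal rectangle. -/
def IsoRectAnchorBridgeAt (α : ℝ) : Prop :=
  (∀ R : Literature.Probability.RandomPlanarGeometry.ConformalRectangle,
      R.HasCrossingLimit
        (fun δ ↦ (Literature.Probability.LatticeModels.prodBernoulli
            (Literature.Probability.Percolation.isoRectCriticalProb α)).real
          (Literature.Probability.Percolation.embDomainCrossing
            (Literature.Probability.Percolation.isoRectEmbedding α) R.carrier δ (R.arc 0) (R.arc 2)))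
        Literature.Probability.RandomPlanarGeometry.cardyFunction) →
    ∀ R : Literature.Probability.RandomPlanarGeometry.ConformalRectangle,
      R.HasCrossingLimit (Literature.Probability.Percolation.bondDomainCrossingProb R)
        Literature.Probability.RandomPlanarGeometry.cardyFunction

/-- **The rung**: for every `α ∈ (0, π)`, crude Cardy on `𝕃(α)` implies Cardy's formula on `ℤ²`. -/
def IsoRectAnchorBridge : Prop :=
  ∀ α ∈ Set.Ioo (0 : ℝ) Real.pi, IsoRectAnchorBridgeAt α

/-! ### Stub statements -/

/-- Stub 1 (the printed input, XL): DKKMO 2020 Thm 2.1 at `q = 1`, per quad — the tree's named fact. -/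
abbrev Sig.stub_dkkmoThm21 : Prop :=
  Literature.Probability.Percolation.DKKMO2020_thm21_quadCrossingProb

/-- Stub 2 (L): upper comparison for `ℤ²`.  Given DKKMO, for every `α ∈ (0,π)`, every conformal
rectangle `R` and `ε > 0`, eventually as `δ → 0⁺` the crude bond-`ℤ²` crossing probability of the
ROTATED quad `rotateQuad (α/2 - π/4) R` at mesh `δ` is at most the crude `𝕃(α)` crossing probability
of `R` at mesh `δ` plus `ε`.  Chain: crude_{ℤ²}(R') ⊆ raw-cross_{ℤ²}(Q'_e) (`crude_subset_crossed`,
`Q_e = rectQuad H (1-s)(1+s)`, primes = rotation by `θ = α/2-π/4`) → `d_SS`-continuity on `ℤ²` at the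
quad of `R'` (prob. loss `ε/2`) → raw-cross_{ℤ²}(Q'_h), `Q_h = rectQuad H (1+s')(1-s')` → DKKMO at the
conformal rectangle modelling `e^{iα/2} Q_h` (loss `ε/2`; `quadCrossingEmb_isoRectDrawing_pi_div_two`)
→ raw-cross_{𝕃(α)}(Q_h) ⊆ crude_{𝕃(α)}(R) (run extraction; edge lengths ≤ 2δ). -/
abbrev Sig.stub_squareLeIsoRect : Prop :=
  Literature.Probability.Percolation.DKKMO2020_thm21_quadCrossingProb →
    ∀ α ∈ Set.Ioo (0 : ℝ) Real.pi,
      ∀ R : Literature.Probability.RandomPlanarGeometry.ConformalRectangle, ∀ ε : ℝ, 0 < ε →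
        ∀ᶠ δ : ℝ in 𝓝[>] (0 : ℝ),
          (Literature.Probability.Percolation.bondPercolation (Literature.Probability.LatticeModels.zdGraph 2)
                Literature.Probability.Percolation.half).real
              (Literature.Probability.Percolation.embDomainCrossing
                Literature.Probability.LatticeModels.squareLatticeEmbedding.z
                (Literature.Probability.Percolation.rotateQuad (α / 2 - Real.pi / 4) R).carrier δ
                ((Literature.Probability.Percolation.rotateQuad (α / 2 - Real.pi / 4) R).arc 0)
                ((Literature.Probability.Percolation.rotateQuad (α / 2 - Real.pi / 4) R).arc 2)) ≤
            (Literature.Probability.LatticeModels.prodBernoulli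
                (Literature.Probability.Percolation.isoRectCriticalProb α)).real
              (Literature.Probability.Percolation.embDomainCrossing
                (Literature.Probability.Percolation.isoRectEmbedding α) R.carrier δ (R.arc 0) (R.arc 2)) + ε

/-- Stub 3 (L): lower comparison for `ℤ²` (the reverse inequality).  Chain: crude_{𝕃(α)}(R) ⊆
raw-cross_{𝕃(α)}(Q_e) (path restriction; edge lengths ≤ 2δ) → DKKMO at the conformal rectangle modelling
`e^{iα/2} Q_e` → raw-cross_{ℤ²}(Q'_e) → `d_SS`-continuity on `ℤ²` at the quad of `R'` →
raw-cross_{ℤ²}(Q'_h) ⊆ crude_{ℤ²}(R') (run extraction on `ℤ²`). -/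
abbrev Sig.stub_isoRectLeSquare : Prop :=
  Literature.Probability.Percolation.DKKMO2020_thm21_quadCrossingProb →
    ∀ α ∈ Set.Ioo (0 : ℝ) Real.pi,
      ∀ R : Literature.Probability.RandomPlanarGeometry.ConformalRectangle, ∀ ε : ℝ, 0 < ε →
        ∀ᶠ δ : ℝ in 𝓝[>] (0 : ℝ),
          (Literature.Probability.LatticeModels.prodBernoulli
                (Literature.Probability.Percolation.isoRectCriticalProb α)).real
              (Literature.Probability.Percolation.embDomainCrossing
                (Literature.Probability.Percolation.isoRectEmbedding α) R.carrier δ (R.arc 0) (R.arc 2)) ≤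
            (Literature.Probability.Percolation.bondPercolation (Literature.Probability.LatticeModels.zdGraph 2)
                Literature.Probability.Percolation.half).real
              (Literature.Probability.Percolation.embDomainCrossing
                Literature.Probability.LatticeModels.squareLatticeEmbedding.z
                (Literature.Probability.Percolation.rotateQuad (α / 2 - Real.pi / 4) R).carrier δ
                ((Literature.Probability.Percolation.rotateQuad (α / 2 - Real.pi / 4) R).arc 0)
                ((Literature.Probability.Percolation.rotateQuad (α / 2 - Real.pi / 4) R).arc 2)) + ε

/-! ### Registered stubs -/

/-- STUB 1 (XL, printed): DKKMO 2020 Thm 2.1 (`q = 1`) per quad [cite: DKKMO2020Rotational, Thm 2.1/1.1]. -/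
theorem stub_dkkmoThm21 : Sig.stub_dkkmoThm21 := by
  sorry

/-- STUB 2 (L): the upper comparison `P_{ℤ²}[crude(R'_θ)] ≤ P_α[crude(R)] + ε`, eventually. -/
theorem stub_squareLeIsoRect : Sig.stub_squareLeIsoRect := by
  sorry

/-- STUB 3 (L): the lower comparison `P_α[crude(R)] ≤ P_{ℤ²}[crude(R'_θ)] + ε`, eventually. -/
theorem stub_isoRectLeSquare : Sig.stub_isoRectLeSquare := by
  sorry

/-! ### Glue (sorry-free) -/

/-- Crossing-limit statements are invariant under rotating the quad (same family `p`, same `F`):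
the conformal modulus is rotation invariant (`hasCrossingLimit_iff_of_image_data`). [folklore] -/
theorem hasCrossingLimit_rotateQuad_iff (θ : ℝ)
    (R : Literature.Probability.RandomPlanarGeometry.ConformalRectangle) (p F : ℝ → ℝ) :
    (Literature.Probability.Percolation.rotateQuad θ R).HasCrossingLimit p F ↔ R.HasCrossingLimit p F := by
  have hfun : (fun z : ℂ => rotation (Circle.exp θ) z) = fun z : ℂ => ((Circle.exp θ : Circle) : ℂ) * z :=
    funext fun z => rotation_apply _ _
  refine Literature.Probability.RandomPlanarGeometry.ConformalRectangle.hasCrossingLimit_iff_of_image_data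
    (R := R) (S := Literature.Probability.Percolation.rotateQuad θ R)
    (h := fun z : ℂ => rotation (Circle.exp θ) z) ?_ (rotation (Circle.exp θ)).injective.injOn
    (rotation (Circle.exp θ)).continuous.continuousOn rfl fun _ => rfl
  rw [hfun]
  exact (differentiable_id.const_mul _).differentiableOn

/-- `rotateQuad θ (rotateQuad (-θ) R) = R`. -/
theorem rotateQuad_rotateQuad_neg (θ : ℝ)
    (R : Literature.Probability.RandomPlanarGeometry.ConformalRectangle) :
    Literature.Probability.Percolation.rotateQuad θ (Literature.Probability.Percolation.rotateQuad (-θ) R) = R := by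
  rw [← Literature.Probability.Percolation.rotateQuad_add, neg_add_cancel,
    Literature.Probability.Percolation.rotateQuad_zero]

/-- **Φ-general crude transport `𝕃(α) → ℤ²`** (the twin of the crux `TriangularToSquareTransport`
with `𝕋 ↦ 𝕃(α)`), from the three stubs: an `ε/3` squeeze at the rotated quad. -/
theorem isoRectToSquareTransport_of (hD : Sig.stub_dkkmoThm21) (hU : Sig.stub_squareLeIsoRect)
    (hL : Sig.stub_isoRectLeSquare) :
    ∀ α ∈ Set.Ioo (0 : ℝ) Real.pi, ∀ Φ : ℝ → ℝ,
      (∀ R : Literature.Probability.RandomPlanarGeometry.ConformalRectangle,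
          R.HasCrossingLimit
            (fun δ ↦ (Literature.Probability.LatticeModels.prodBernoulli
                (Literature.Probability.Percolation.isoRectCriticalProb α)).real
              (Literature.Probability.Percolation.embDomainCrossing
                (Literature.Probability.Percolation.isoRectEmbedding α) R.carrier δ (R.arc 0) (R.arc 2))) Φ) →
      ∀ R : Literature.Probability.RandomPlanarGeometry.ConformalRectangle,
        R.HasCrossingLimit
          (fun δ ↦ (Literature.Probability.Percolation.bondPercolation
              (Literature.Probability.LatticeModels.zdGraph 2) Literature.Probability.Percolation.half).real
            (Literature.Probability.Percolation.embDomainCrossing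
              Literature.Probability.LatticeModels.squareLatticeEmbedding.z R.carrier δ (R.arc 0) (R.arc 2))) Φ := by
  intro α hα Φ hiso R'
  -- the un-rotated quad `R` with `rotateQuad θ R = R'`
  set θ : ℝ := α / 2 - Real.pi / 4 with hθ
  set R : Literature.Probability.RandomPlanarGeometry.ConformalRectangle :=
    Literature.Probability.Percolation.rotateQuad (-θ) R' with hR
  have hRR' : Literature.Probability.Percolation.rotateQuad θ R = R' := rotateQuad_rotateQuad_neg θ R'
  -- the `𝕃(α)` limit at `R`, read at the quad `R'` (rotation invariance of the modulus)
  have hisoR' : R'.HasCrossingLimit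
      (fun δ ↦ (Literature.Probability.LatticeModels.prodBernoulli
          (Literature.Probability.Percolation.isoRectCriticalProb α)).real
        (Literature.Probability.Percolation.embDomainCrossing
          (Literature.Probability.Percolation.isoRectEmbedding α) R.carrier δ (R.arc 0) (R.arc 2))) Φ := by
    rw [← hRR']
    exact (hasCrossingLimit_rotateQuad_iff θ R _ Φ).2 (hiso R)
  intro φ x hux
  have hlim := hisoR' φ x hux
  have hUR := hU hD α hα R
  have hLR := hL hD α hα R
  rw [hRR'] at hUR hLR
  rw [Metric.tendsto_nhds]
  intro ε hε
  have hε3 : 0 < ε / 3 := by positivity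
  have h1 := hUR (ε / 3) hε3
  have h2 := hLR (ε / 3) hε3
  have h3 := Metric.tendsto_nhds.1 hlim (ε / 3) hε3
  filter_upwards [h1, h2, h3] with δ h1δ h2δ h3δ
  rw [Real.dist_eq, abs_sub_lt_iff] at h3δ ⊢
  obtain ⟨h3a, h3b⟩ := h3δ
  constructor <;> linarith

/-- **The line closes the rung.** Transport at `Φ = cardyFunction`, then the FLOOR
`DiscretisationBridge_skeleton` (crude Cardy on `ℤ²` ⇒ G02 Cardy on `ℤ²`). -/
theorem IsoRectAnchorBridge_of :
    Sig.stub_dkkmoThm21 → Sig.stub_squareLeIsoRect → Sig.stub_isoRectLeSquare → IsoRectAnchorBridge := by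
  intro hD hU hL α hα h R
  exact Summit.CriticalPhenomena.CardyFormulaZ2.Cruxes.DiscretisationBridge.Birth.DiscretisationBridge_skeleton R
    (isoRectToSquareTransport_of hD hU hL α hα Literature.Probability.RandomPlanarGeometry.cardyFunction h R)

/-- The rung from the registered stubs. -/
theorem IsoRectAnchorBridge_of_stubs : IsoRectAnchorBridge :=
  IsoRectAnchorBridge_of stub_dkkmoThm21 stub_squareLeIsoRect stub_isoRectLeSquare

/-- Sanity (F3): the member `α = π/2` of the rung is the floor, unconditionally (no stub). -/
theorem IsoRectAnchorBridgeAt_pi_div_two : IsoRectAnchorBridgeAt (Real.pi / 2) := by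
  intro h R
  refine Summit.CriticalPhenomena.CardyFormulaZ2.Cruxes.DiscretisationBridge.Birth.DiscretisationBridge_skeleton R ?_
  simpa only [funext Literature.Probability.Percolation.isoRectEmbedding_pi_div_two,
    Literature.Probability.Percolation.prodBernoulli_isoRectCriticalProb_pi_div_two] using h R

end Summit.CriticalPhenomena.CardyFormulaZ2.Cruxes.TriangularToSquareTransport.IsoRectRung
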